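import Summits.QuantumFields.YangMills.Theorems.BalabanUVNodesN16AtRecord13OfEdges
import Summits.QuantumFields.YangMills.Theorems.BalabanUVNodesN16AtReadingOfRecord13CoPH
import Summits.QuantumFields.YangMills.Theorems.BalabanUVNodesN16HolderMSSlotWindowCoPH
/-!
# Route «BalabanUVNodes», cluster K4 «SpineRates» — node N16 = NE3 AT THE STAGE-13 READING OF RECORD FROM ITS TWO IN-EDGES BY NAME, LETTERS CHOSEN: N05's leaf
# (`Thm4Body` ∕ `Prop3Body` on the univ sub-family of `zdGF3 (M_N ℂ) F.L β len`) and N07's LINEAR leaf (`LeafH3sup … ε (C·ε) (C·ε)` for every small class radius `ε`), once per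
# family, give SOME letters of record `ℓ₃` with `S_N16 (RRec₁₃CoPHOn (readingOfRecord₁₃CoPH w1 ℓ₃ ne2 ne1) Rg)` (β = 1, the stub of record) — resp. `S_N16HolderMS β (…)` (repair R-β″)
# — TOGETHER WITH dag-n21-d's numerals and THE END's proviso at the same letters; no letter line is left to the composer

CoPH EDITION (FINDING №9 = node00-def-T LOCATED-9 «history-blind residual 𝐓-weight slot»; director-ym №183 H1ʰ ∕ №186 (α) ∕ №190 PRESS WORD; node00-def-T FILE 27 `Node00/Record13CoPH.lean`
p537939 + FILE 28T `Node00/Record13SepCoPH.lean` p539169, T₇ = KEY-RULE-27 ∕ `KEYMAP-Record13-v1.7.md`; plan rev 24; dag-lead DEDUP-301 «v1.7 porters UNGATED → GO» ∕ DEDUP-302 — 2026-08-27):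
RECORD 13 v1.7 indexes the residual 𝐓-weight slot by the WHOLE history — `structure Stage13HParams … extends Stage13RParams` with the fields `Zh : (p : B12.RunParams) → ℕ →
(ℕ → Set (Site (Fam.P p.K) 0)) → (ℕ → Set (Site (Fam.P p.K) 0)) → TkResidualW Fam N (FluctV N) p.K` and `Phih`, readers `zhAt ∕ rzAt`, guard `Stage13HParams.ZhUnity`, proviso
`Stage13HParams.Provisos₁₃CoPH` (rows `zhLaws ∕ zhLocal`), `towerOfRecord₁₃CoPH ∕ datumOfRecord₁₃CoPH`, record class `IsRecordOfRecord₁₃CCoPH`, door `Stage13HParams.ofHistoryBlind`; node00-def-RR-2's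
key `Node00/Record13DatumKeyCoPH` p539151 (`IsDatumOfRecord₁₃CCoPH(On∕N)`, `.params ∕ .provisos ∕ .admissible`, `isDatumOfRecord₁₃CCoPH_datumOfRecord₁₃CoPH`, guard of record `unityNondeg₁₃H`) and
dag-n22-e's (T-RATE) layer-B ∕ reading-of-record CoPH ports (`RateReading₁₃CoPH`, `rateCarriersOfRecord₁₃CoPH`, `RRec₁₃CoPH`, `RRec₁₃CoPHOn`, `readingOfRecord₁₃CoPH`, …) followed; the items re-key to
⁷ (`…R13SepCoPH`, plan rev 24 ∕ dag-lead WORDS-143), bg-blind consumer storeys port their OWN files (director-ym №174 (3) standing).  THIS FILE is the TOKEN TWIN of this seat's v1.6 module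
`…N16AtRecord13CoPROfEdges` (p541645) under T₇: binder `(θ : Stage13RParams F N) ↦ (θ : Stage13HParams F N)` (regimes `Rg`, run-length selectors `ksel`, tuple readings `rr` re-typed
with it; `θ.Admissible F N` read through the ancestor structures), `Provisos₁₃CoPR ↦ Provisos₁₃CoPH`, every `…CoPR…` record ∕ key ∕ home ∕ reading ∕ module stem `↦ …CoPH…`, guard
`unityNondeg₁₃R ↦ unityNondeg₁₃H` (prose only here) — statements = the v1.6 statements under that map; proofs VERBATIM; θ-free names (RR-1's `ne3ConstLayerOfRecord₁₁` ∕ `ne3NperOfRecord₁₁` ∕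
`ne3DomOfRecord₁₁`, `InEndRegime`, `LeafSlot`, the AT slots, dag-n16-c's β-kit, …) VERBATIM; stage-free lemmas NOT re-declared (imported BY NAME); N16 reads no field of the key (no `Zh ∕ Zr ∕
Zt`, no `bg`, no transport face — T₇'s SITE RULE S₇ has no site in this file); the tuple-currency (K3 `KeyedRates rr`) conjuncts are CITED from this seat's BINDER-GENERIC modules
`…N16AtTupleReadingBinderGeneric` ∕ `…N16HolderMSAtTupleReadingBinderGeneric` (p530924 ∕ p531947: key type, proviso and admissibility are variables — NO port needed at this or any
later edition).  NOTE (LOCATED-4∕5 of dag-n16-e ∕ dag-n16-c): every «THE N16 LINE» keyed on the law-free univ sub-family is VACUOUS as stated (n16-c F49); the LIVE lines carry N05's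
conjunct at the pinned all-torus proper sub-index (`…AllTorusAtRecord13CoPH`).  The v1.6 CoPR ∕ v1.5 CoP ∕ Co ∕ ⁗ ∕ ‴ siblings and the item ids they name are ASIDES; the lane is
K3⁷ `SpineGivenEndpointR13SepCoPH` = stmt-QuantumFields-20544 (plan g73 REV24-BORN l.20848; dag-lead WORDS-143),
filed `--kind proof --supports stmt-QuantumFields-20544 --as helper`.

Cell `pub-ymgap`, seat `pub-ymgap-dag-n16-e` (R134 acceleration seat (a), strategy s2 = BY-NAME KNIT at the record; HUMAN RULING D-0062; chair R424 venue), generation 8,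
module 27ᴴ (THEOREMS ONLY, 0 `def`, 0 `sorry`).  `bears_on: R4∕N16 · edges N05 → N16, N07 → N16 · out-edge N16 → N21 · K3‴ SpineGivenEndpointR13 (stmt-QuantumFields-19912,
`--supports … --as helper`)`.

WHY.  Every N16 LINE in the tree (module 20 §4∕§5, 23 §2∕§3, 26 §3; files 14∕17∕18 at ₁₂) takes the letters `ℓ₃ F`, the averaging letter `α F` and N07's leaf letters
`b' F, c' F` as PARAMETERS under ≈ 20 displayed letter lines, and proves separately that the lines are jointly satisfiable (`exists_window_letters_numerals(_H∕_HMS)`).  A composer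
at the reading of record (dag-n27-c XXXVII §8 ∕ XL ∕ XLI, plan g66's `stub_rates13`) would still have to CHOOSE the letters and thread the lines.  Here the choice is MADE, once per
family, from the two in-edge interfaces stated in their producers' own currencies and asked UNGUARDED (both are about `F.L`-indexed objects — N05's GF-data family on `ℤ⁴` and
RR-1's `2·L^m`-periodic `SU(N)` data — and do not read the Stage-13 tuple): N05 = its Thm-4 ∕ Prop-3 bodies with their constants and window (n05-a's leaf of record, unpacked as in
`…N16LeafSlotRS`), N07 = [Balaban1985Variational] Thm 1 (8)+(10) TYPE with LINEAR regularity letters `b = c = C·ε` below a class-radius threshold `ε₀` (dag-ref-B READ-445's linear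
recipe, file 17).  The letters are those of `exists_window_letters_numerals` with the class radius shrunk below `ε₀` and `α∕(2048·(C+1))`, so N07's `C·ε` meets the slot's
`b' ≤ α∕2048`, `c' ≤ α∕24`.

CONTENT.
§1 (‴ ONLY, stage-free, imported BY NAME from `…N16AtRecord13OfEdges`): `exists_window_letters_linearLeaf` and the per-family lemmas
  `exists_letters_inEndRegime_leafSlot_of_edges` ∕ `exists_letters_inEndRegimeHMS_leafSlotHolderMS_of_edges` — not re-declared here.
§2 β = 1 (THE STUB OF RECORD): per family `exists_letters_inEndRegime_leafSlot_of_edges` (`∃ ℓ`, `ℓ.g = g`, THE END's proviso `InEndRegime` and n16-e's `LeafSlot` at RR-1's object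
  with letters `ℓ`, N21's numerals, `ℓ.Λ₁ = radiusOfRecord …`); ★ `exists_letters_s_N16_readingOfRecord₁₃CoPHOn_of_edges` (`∃ ℓ₃`, the K3‴ composer's `h16` at dag-n22-e's named
  reading + the per-family facts), `exists_letters_s_N16_readingOfRecord₁₃CoPH_of_edges` (canonical home).
§3 R-β″ (`S_N16HolderMS β`, `0 ≤ β ≤ 1`; N05's family at exponent `β` with the MS length letter `len (j • e μ) = j`): `exists_letters_inEndRegimeHMS_leafSlotHolderMS_of_edges`,
  ★ `exists_letters_s_N16HolderMS_readingOfRecord₁₃CoPHOn_of_edges`, `exists_letters_s_N16HolderMS_readingOfRecord₁₃CoPH_of_edges` (thresholds `radiusOfRecordHMS` ∕ `constOfRecordHMS`).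
(The R-β currency `S_N16Holder β` is the same text over (F2)'s `leafSlotHolder_ofRecord_of_window_linear` ∕ `inEndRegimeH_ofRecord_of_window`; on ask.)

HONEST FRAMING.  Kernel bookkeeping by name + letter arithmetic; no estimate; N05's `Thm4Body` ∕ `Prop3Body` ([Balaban1985RegularSpaces] Thm 4 ∕ Prop 3 as typed by n05-a,
all-torus sub-family) and N07's linear `LeafH3sup` ([Balaban1985Variational] Thm 1 (8)+(10) TYPE) are HYPOTHESES asserted for no family — this file CHOOSES LETTERS, it proves
neither edge; the localisation letters of the slot witness are DEGENERATE (`Mc := 0`, `C₃₃₅ := 1`, `𝒬 := ∅`, files 17 ∕ 26); `S_N16HolderMS β` is a CANDIDATE stub (R-β″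
UNRULED); the reading's `w1` ∕ `ne2` ∕ `ne1` are residual DATA; no admissible Stage-13 tuple with provisos is claimed to exist (K0‴ `Record13Inhabited`, stmt-QuantumFields-19909,
OPEN); nothing of Bałaban's asserted; **N16 ∕ NE3 is NOT discharged**; count-neutral (typed 28∕28 · discharged 5∕27, A 5∕28 UNMOVED); one finite four-torus at fixed ε — NOT ℝ⁴,
NOT infinite volume, NOT OS, NOT a mass gap, NOT Clay.  No decl below carries a cite tag (all `[folklore]` bookkeeping).
-/

set_option autoImplicit false

open scoped BigOperators Matrix Matrix.Norms.L2Operator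
open NormedSpace

namespace Summit.QuantumFields.YangMills.BalabanUVNodes.N16AtRecord13CoPHOfEdges

open Literature.MathematicalPhysics.QuantumFieldTheory.Balaban1983to89
open Literature.MathematicalPhysics.QuantumFieldTheory.Balaban1983to89.T4Continuum (T4Family ULoop)
open B7Prop1Explicit B7Prop2Explicit
open B7Prop3Flat (c3)
open B8LeafModelZd (ZdIdx)
open B8LeafModelZd3 (zdGF3)
open Node00 (IsDatumOfRecord₁₃CCoPH Stage13HParams NE3Objects₁₁ NE3Letters₁₁ NE2Objects₁₁ ne3ConstLayerOfRecord₁₁ ne3NperOfRecord₁₁ ne3DomOfRecord₁₁ one_le_ne3NperOfRecord₁₁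
  MatA)
open Node00.W1 (ReadingData)
open Summit.QuantumFields.BalabanUV.T4Continuum
open BlockAverageCurrent (curConst curConst_nonneg)
open NE3RightInverseSupLetters (frameC)
open NE3.LeafIndexSockets (LeafH3sup)
open YMDAG.UVSplit (Datum NE3Carriers NE1pCarriers S_N16 ne3OfRecord₁₁ RRec₁₃CoPH RRec₁₃CoPHOn readingOfRecord₁₃CoPH)
open Summit.QuantumFields.YangMills.BalabanUVNodes.N16Regime (InEndRegime radiusOfRecord constOfRecord)
open Summit.QuantumFields.YangMills.BalabanUVNodes.N16LeafSlot (LeafSlot)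
open Summit.QuantumFields.YangMills.BalabanUVNodes.N16AtReadingOfRecord13CoPH (s_N16_readingOfRecord₁₃CoPHOn_of_leafSlot s_N16_readingOfRecord₁₃CoPH_of_leafSlot)
open Summit.QuantumFields.YangMills.BalabanUVNodes.N16HolderMSDefs (S_N16HolderMS)
open Summit.QuantumFields.YangMills.BalabanUVNodes.N16HolderMSRegime (InEndRegimeHMS radiusOfRecordHMS constOfRecordHMS radiusOfRecordHMS_pos)
open Summit.QuantumFields.YangMills.BalabanUVNodes.N16HolderMSLeafSlot (LeafSlotHolderMS)
open Summit.QuantumFields.YangMills.BalabanUVNodes.N16HolderMSSlotWindowCoPH (s_N16HolderMS_rRec₁₃CoPHOn_of_constLayer_leafSlotHolderMS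
  s_N16HolderMS_rRec₁₃CoPH_of_constLayer_leafSlotHolderMS)
open Summit.QuantumFields.YangMills.BalabanUVNodes.N16AtRecord13OfEdges (exists_letters_inEndRegime_leafSlot_of_edges
  exists_letters_inEndRegimeHMS_leafSlotHolderMS_of_edges)

noncomputable section

variable {N : ℕ} [NeZero N]

/-! ## §2 β = 1, THE STUB OF RECORD: letters chosen from N05's leaf and N07's linear leaf, per family; the composer's `h16` at the named reading -/

section Record

variable (Rg : (F : T4Family) → Stage13HParams F N → Prop)
  (w1 : (F : T4Family) → (θ : Stage13HParams F N) → ReadingData F (MatA N) θ.τ9.M)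
  (ne2 : (F : T4Family) → Stage13HParams F N → (ℕ → ℝ) → List (ULoop F) → ℕ → NE2Objects₁₁)
  (ne1 : (F : T4Family) → Stage13HParams F N → (ℕ → ℝ) → List (ULoop F) → NE1pCarriers)

/-- ★ **N16 AT THE REGIME-RESTRICTED READING OF RECORD FROM ITS TWO IN-EDGES, LETTERS CHOSEN** (β = 1): N05's unpacked leaf and N07's linear leaf at EVERY family (both are about
`F.L`-indexed objects and read no Stage-13 tuple), and a coupling letter `g F > 0`, give letters of record `ℓ₃` with the K3‴ composer's
`h16 : S_N16 (RRec₁₃CoPHOn (readingOfRecord₁₃CoPH w1 ℓ₃ ne2 ne1) Rg)` (module 23's `s_N16_readingOfRecord₁₃CoPHOn_of_leafSlot`) AND, at every family, THE END's proviso, `LeafSlot`, and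
dag-n21-d's numerals at `ℓ₃ F` — no letter line is left to the composer; `Rg`, `w1`, `ne2`, `ne1` free. [folklore] -/
theorem exists_letters_s_N16_readingOfRecord₁₃CoPHOn_of_edges {g : T4Family → ℝ} (hg : ∀ F, 0 < g F)
    (h5 : ∀ F : T4Family, letI : CStarAlgebra (Matrix (Fin N) (Fin N) ℂ) := {}
      ∃ (len : Site 4 → ℝ) (c₁ c₁' B₁' cP C₂ B₀β : ℝ) (inp : B8.B9Inputs),
        (∀ v : Site 4, 0 < len v → 1 ≤ len v) ∧ (∀ μ : Fin 4, len (e μ) = 1) ∧ 0 < B₁' ∧ 5 * ((4 : ℕ) : ℝ) * F.L * inp.B₀ ≤ B₁' ∧ 0 < c₁' ∧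
        (∀ α₀ α₁ : ℝ, 0 < α₀ → 0 < α₁ → α₀ + α₁ ≤ c₁' →
          α₀ + α₁ ≤ c₁ ∧ C0 4 * (2 * α₀) ≤ 1 / 3 ∧ 4 * α₀ ≤ c2' 4 F.L ∧ 16 * (B₁' * (α₀ + α₁)) ≤ 1 ∧
          Real.exp (4 * (800 * (((4 : ℕ) : ℝ) + 1) ^ 2 * (((4 : ℕ) : ℝ) + 4)) * α₀) * (1 + 8 * (131072 * (((4 : ℕ) : ℝ) + 1) ^ 2) * (B₁' * (α₀ + α₁))) ≤ 2 ∧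
          2 * (B₁' * (α₀ + α₁)) ≤ c3 4 F.L ∧ ((4 : ℕ) : ℝ) * F.L * α₁ ≤ 1 / 8 ∧ α₀ ≤ cP ∧ α₁ ≤ cP ∧ B₁' * (α₀ + α₁) ≤ cP ∧
          2 * (B₁' * (α₀ + α₁)) ^ 2 + 20 * ((4 : ℕ) : ℝ) * α₀ * (B₁' * (α₀ + α₁)) + 2 * C₂ * (B₁' * (α₀ + α₁)) ^ 2 ≤ α₀ + α₁) ∧
        B8.Thm4Body c₁ B₁' (fun i : {i : ZdIdx 4 F.L // i.Ω 0 = Set.univ} => (zdGF3 (Matrix (Fin N) (Fin N) ℂ) F.L 1 len i.1).toGFData) ∧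
        B8.Prop3Body cP 4 (F.L : ℝ) C₂ inp B₀β (fun i : {i : ZdIdx 4 F.L // i.Ω 0 = Set.univ} => (zdGF3 (Matrix (Fin N) (Fin N) ℂ) F.L 1 len i.1).toGFData2))
    (h7 : ∀ F : T4Family, ∃ C ε₀ : ℝ, 0 ≤ C ∧ 0 < ε₀ ∧ ∀ ε : ℝ, 0 < ε → ε ≤ ε₀ →
      LeafH3sup 4 F.L (ne3NperOfRecord₁₁ F 0 0) ε (C * ε) (C * ε) (ne3DomOfRecord₁₁ F N 0 0)) :
    ∃ ℓ₃ : T4Family → NE3Letters₁₁,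
      S_N16 (RRec₁₃CoPHOn (readingOfRecord₁₃CoPH w1 ℓ₃ ne2 ne1) Rg) ∧
      ∀ F : T4Family, (ℓ₃ F).g = g F ∧ (ℓ₃ F).Λ₁ = radiusOfRecord N F.L (ne3NperOfRecord₁₁ F 0 0) ∧ (ℓ₃ F).C = constOfRecord N F.L (ne3NperOfRecord₁₁ F 0 0) (g F) ∧
        0 < (ℓ₃ F).b ∧ 512 * (4 + 1) * (4 + 4) * (F.L : ℝ) ^ 2 * (ℓ₃ F).b ≤ 1 ∧ 0 < (ℓ₃ F).Λ₂' ∧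
        InEndRegime (ne3OfRecord₁₁ F (ne3ConstLayerOfRecord₁₁ F N (ℓ₃ F))) ∧ LeafSlot (ne3OfRecord₁₁ F (ne3ConstLayerOfRecord₁₁ F N (ℓ₃ F))) := by
  choose ℓ₃ hℓ₃ using fun F => exists_letters_inEndRegime_leafSlot_of_edges (N := N) F (hg F) (h5 F) (h7 F)
  exact ⟨ℓ₃, s_N16_readingOfRecord₁₃CoPHOn_of_leafSlot Rg w1 ℓ₃ ne2 ne1 (fun F _ => (hℓ₃ F).2.2.2.2.2.2), hℓ₃⟩

/-- **THE SAME AT THE CANONICAL READING OF RECORD** (`S_N16 (RRec₁₃CoPH (readingOfRecord₁₃CoPH w1 ℓ₃ ne2 ne1))`, module 23's `s_N16_readingOfRecord₁₃CoPH_of_leafSlot`). [folklore] -/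
theorem exists_letters_s_N16_readingOfRecord₁₃CoPH_of_edges {g : T4Family → ℝ} (hg : ∀ F, 0 < g F)
    (h5 : ∀ F : T4Family, letI : CStarAlgebra (Matrix (Fin N) (Fin N) ℂ) := {}
      ∃ (len : Site 4 → ℝ) (c₁ c₁' B₁' cP C₂ B₀β : ℝ) (inp : B8.B9Inputs),
        (∀ v : Site 4, 0 < len v → 1 ≤ len v) ∧ (∀ μ : Fin 4, len (e μ) = 1) ∧ 0 < B₁' ∧ 5 * ((4 : ℕ) : ℝ) * F.L * inp.B₀ ≤ B₁' ∧ 0 < c₁' ∧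
        (∀ α₀ α₁ : ℝ, 0 < α₀ → 0 < α₁ → α₀ + α₁ ≤ c₁' →
          α₀ + α₁ ≤ c₁ ∧ C0 4 * (2 * α₀) ≤ 1 / 3 ∧ 4 * α₀ ≤ c2' 4 F.L ∧ 16 * (B₁' * (α₀ + α₁)) ≤ 1 ∧
          Real.exp (4 * (800 * (((4 : ℕ) : ℝ) + 1) ^ 2 * (((4 : ℕ) : ℝ) + 4)) * α₀) * (1 + 8 * (131072 * (((4 : ℕ) : ℝ) + 1) ^ 2) * (B₁' * (α₀ + α₁))) ≤ 2 ∧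
          2 * (B₁' * (α₀ + α₁)) ≤ c3 4 F.L ∧ ((4 : ℕ) : ℝ) * F.L * α₁ ≤ 1 / 8 ∧ α₀ ≤ cP ∧ α₁ ≤ cP ∧ B₁' * (α₀ + α₁) ≤ cP ∧
          2 * (B₁' * (α₀ + α₁)) ^ 2 + 20 * ((4 : ℕ) : ℝ) * α₀ * (B₁' * (α₀ + α₁)) + 2 * C₂ * (B₁' * (α₀ + α₁)) ^ 2 ≤ α₀ + α₁) ∧
        B8.Thm4Body c₁ B₁' (fun i : {i : ZdIdx 4 F.L // i.Ω 0 = Set.univ} => (zdGF3 (Matrix (Fin N) (Fin N) ℂ) F.L 1 len i.1).toGFData) ∧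
        B8.Prop3Body cP 4 (F.L : ℝ) C₂ inp B₀β (fun i : {i : ZdIdx 4 F.L // i.Ω 0 = Set.univ} => (zdGF3 (Matrix (Fin N) (Fin N) ℂ) F.L 1 len i.1).toGFData2))
    (h7 : ∀ F : T4Family, ∃ C ε₀ : ℝ, 0 ≤ C ∧ 0 < ε₀ ∧ ∀ ε : ℝ, 0 < ε → ε ≤ ε₀ →
      LeafH3sup 4 F.L (ne3NperOfRecord₁₁ F 0 0) ε (C * ε) (C * ε) (ne3DomOfRecord₁₁ F N 0 0)) :
    ∃ ℓ₃ : T4Family → NE3Letters₁₁,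
      S_N16 (RRec₁₃CoPH (readingOfRecord₁₃CoPH w1 ℓ₃ ne2 ne1)) ∧
      ∀ F : T4Family, (ℓ₃ F).g = g F ∧ (ℓ₃ F).Λ₁ = radiusOfRecord N F.L (ne3NperOfRecord₁₁ F 0 0) ∧ (ℓ₃ F).C = constOfRecord N F.L (ne3NperOfRecord₁₁ F 0 0) (g F) ∧
        0 < (ℓ₃ F).b ∧ 512 * (4 + 1) * (4 + 4) * (F.L : ℝ) ^ 2 * (ℓ₃ F).b ≤ 1 ∧ 0 < (ℓ₃ F).Λ₂' ∧
        InEndRegime (ne3OfRecord₁₁ F (ne3ConstLayerOfRecord₁₁ F N (ℓ₃ F))) ∧ LeafSlot (ne3OfRecord₁₁ F (ne3ConstLayerOfRecord₁₁ F N (ℓ₃ F))) := by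
  choose ℓ₃ hℓ₃ using fun F => exists_letters_inEndRegime_leafSlot_of_edges (N := N) F (hg F) (h5 F) (h7 F)
  exact ⟨ℓ₃, s_N16_readingOfRecord₁₃CoPH_of_leafSlot w1 ℓ₃ ne2 ne1 (fun F _ => (hℓ₃ F).2.2.2.2.2.2), hℓ₃⟩

end Record

/-! ## §3 Repair R-β″ (`S_N16HolderMS β`, `0 ≤ β ≤ 1`): N05's family at exponent `β` with the MS length letter; MS thresholds -/

section MS

variable {β : ℝ} (hβ0 : 0 ≤ β) (hβ1 : β ≤ 1) (Rg : (F : T4Family) → Stage13HParams F N → Prop)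
  (w1 : (F : T4Family) → (θ : Stage13HParams F N) → ReadingData F (MatA N) θ.τ9.M)
  (ne2 : (F : T4Family) → Stage13HParams F N → (ℕ → ℝ) → List (ULoop F) → ℕ → NE2Objects₁₁)
  (ne1 : (F : T4Family) → Stage13HParams F N → (ℕ → ℝ) → List (ULoop F) → NE1pCarriers)

include hβ0 hβ1

/-- ★ **N16 UNDER R-β″ AT THE REGIME-RESTRICTED READING OF RECORD FROM ITS TWO IN-EDGES, LETTERS CHOSEN** (`0 ≤ β ≤ 1`): N05's unpacked leaf at exponent `β` (MS length letter) and
N07's linear leaf at every family, `g F > 0`, give letters `ℓ₃` with `S_N16HolderMS β (RRec₁₃CoPHOn (readingOfRecord₁₃CoPH w1 ℓ₃ ne2 ne1) Rg)` AND the per-family MS proviso, MS slot and N21's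
numerals (module 26's const-layer closer at `hpin := rfl`). [folklore] -/
theorem exists_letters_s_N16HolderMS_readingOfRecord₁₃CoPHOn_of_edges {g : T4Family → ℝ} (hg : ∀ F, 0 < g F)
    (h5 : ∀ F : T4Family, letI : CStarAlgebra (Matrix (Fin N) (Fin N) ℂ) := {}
      ∃ (len : Site 4 → ℝ) (c₁ c₁' B₁' cP C₂ B₀β : ℝ) (inp : B8.B9Inputs),
        (∀ v : Site 4, 0 < len v → 1 ≤ len v) ∧ (∀ (μ : Fin 4) (j : ℕ), len (j • e μ) = j) ∧ 0 < B₁' ∧ 5 * ((4 : ℕ) : ℝ) * F.L * inp.B₀ ≤ B₁' ∧ 0 < c₁' ∧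
        (∀ α₀ α₁ : ℝ, 0 < α₀ → 0 < α₁ → α₀ + α₁ ≤ c₁' →
          α₀ + α₁ ≤ c₁ ∧ C0 4 * (2 * α₀) ≤ 1 / 3 ∧ 4 * α₀ ≤ c2' 4 F.L ∧ 16 * (B₁' * (α₀ + α₁)) ≤ 1 ∧
          Real.exp (4 * (800 * (((4 : ℕ) : ℝ) + 1) ^ 2 * (((4 : ℕ) : ℝ) + 4)) * α₀) * (1 + 8 * (131072 * (((4 : ℕ) : ℝ) + 1) ^ 2) * (B₁' * (α₀ + α₁))) ≤ 2 ∧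
          2 * (B₁' * (α₀ + α₁)) ≤ c3 4 F.L ∧ ((4 : ℕ) : ℝ) * F.L * α₁ ≤ 1 / 8 ∧ α₀ ≤ cP ∧ α₁ ≤ cP ∧ B₁' * (α₀ + α₁) ≤ cP ∧
          2 * (B₁' * (α₀ + α₁)) ^ 2 + 20 * ((4 : ℕ) : ℝ) * α₀ * (B₁' * (α₀ + α₁)) + 2 * C₂ * (B₁' * (α₀ + α₁)) ^ 2 ≤ α₀ + α₁) ∧
        B8.Thm4Body c₁ B₁' (fun i : {i : ZdIdx 4 F.L // i.Ω 0 = Set.univ} => (zdGF3 (Matrix (Fin N) (Fin N) ℂ) F.L β len i.1).toGFData) ∧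
        B8.Prop3Body cP 4 (F.L : ℝ) C₂ inp B₀β (fun i : {i : ZdIdx 4 F.L // i.Ω 0 = Set.univ} => (zdGF3 (Matrix (Fin N) (Fin N) ℂ) F.L β len i.1).toGFData2))
    (h7 : ∀ F : T4Family, ∃ C ε₀ : ℝ, 0 ≤ C ∧ 0 < ε₀ ∧ ∀ ε : ℝ, 0 < ε → ε ≤ ε₀ →
      LeafH3sup 4 F.L (ne3NperOfRecord₁₁ F 0 0) ε (C * ε) (C * ε) (ne3DomOfRecord₁₁ F N 0 0)) :
    ∃ ℓ₃ : T4Family → NE3Letters₁₁,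
      S_N16HolderMS β (RRec₁₃CoPHOn (readingOfRecord₁₃CoPH w1 ℓ₃ ne2 ne1) Rg) ∧
      ∀ F : T4Family, (ℓ₃ F).g = g F ∧ (ℓ₃ F).Λ₁ = radiusOfRecordHMS N F.L (ne3NperOfRecord₁₁ F 0 0) ∧
        (ℓ₃ F).C = constOfRecordHMS N F.L (ne3NperOfRecord₁₁ F 0 0) (g F) ∧
        0 < (ℓ₃ F).b ∧ 512 * (4 + 1) * (4 + 4) * (F.L : ℝ) ^ 2 * (ℓ₃ F).b ≤ 1 ∧ 0 < (ℓ₃ F).Λ₂' ∧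
        InEndRegimeHMS (ne3OfRecord₁₁ F (ne3ConstLayerOfRecord₁₁ F N (ℓ₃ F))) ∧ LeafSlotHolderMS (ne3OfRecord₁₁ F (ne3ConstLayerOfRecord₁₁ F N (ℓ₃ F))) β := by
  choose ℓ₃ hℓ₃ using fun F => exists_letters_inEndRegimeHMS_leafSlotHolderMS_of_edges (N := N) (β := β) F (hg F) (h5 F) (h7 F)
  exact ⟨ℓ₃, s_N16HolderMS_rRec₁₃CoPHOn_of_constLayer_leafSlotHolderMS hβ0 hβ1 _ Rg (fun F => ne3ConstLayerOfRecord₁₁ F N (ℓ₃ F)) (fun _ _ _ _ _ _ => rfl)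
    (fun F _ => (hℓ₃ F).2.2.2.2.2.2), hℓ₃⟩

/-- **THE SAME AT THE CANONICAL READING OF RECORD** (`S_N16HolderMS β (RRec₁₃CoPH (readingOfRecord₁₃CoPH w1 ℓ₃ ne2 ne1))`). [folklore] -/
theorem exists_letters_s_N16HolderMS_readingOfRecord₁₃CoPH_of_edges {g : T4Family → ℝ} (hg : ∀ F, 0 < g F)
    (h5 : ∀ F : T4Family, letI : CStarAlgebra (Matrix (Fin N) (Fin N) ℂ) := {}
      ∃ (len : Site 4 → ℝ) (c₁ c₁' B₁' cP C₂ B₀β : ℝ) (inp : B8.B9Inputs),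
        (∀ v : Site 4, 0 < len v → 1 ≤ len v) ∧ (∀ (μ : Fin 4) (j : ℕ), len (j • e μ) = j) ∧ 0 < B₁' ∧ 5 * ((4 : ℕ) : ℝ) * F.L * inp.B₀ ≤ B₁' ∧ 0 < c₁' ∧
        (∀ α₀ α₁ : ℝ, 0 < α₀ → 0 < α₁ → α₀ + α₁ ≤ c₁' →
          α₀ + α₁ ≤ c₁ ∧ C0 4 * (2 * α₀) ≤ 1 / 3 ∧ 4 * α₀ ≤ c2' 4 F.L ∧ 16 * (B₁' * (α₀ + α₁)) ≤ 1 ∧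
          Real.exp (4 * (800 * (((4 : ℕ) : ℝ) + 1) ^ 2 * (((4 : ℕ) : ℝ) + 4)) * α₀) * (1 + 8 * (131072 * (((4 : ℕ) : ℝ) + 1) ^ 2) * (B₁' * (α₀ + α₁))) ≤ 2 ∧
          2 * (B₁' * (α₀ + α₁)) ≤ c3 4 F.L ∧ ((4 : ℕ) : ℝ) * F.L * α₁ ≤ 1 / 8 ∧ α₀ ≤ cP ∧ α₁ ≤ cP ∧ B₁' * (α₀ + α₁) ≤ cP ∧
          2 * (B₁' * (α₀ + α₁)) ^ 2 + 20 * ((4 : ℕ) : ℝ) * α₀ * (B₁' * (α₀ + α₁)) + 2 * C₂ * (B₁' * (α₀ + α₁)) ^ 2 ≤ α₀ + α₁) ∧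
        B8.Thm4Body c₁ B₁' (fun i : {i : ZdIdx 4 F.L // i.Ω 0 = Set.univ} => (zdGF3 (Matrix (Fin N) (Fin N) ℂ) F.L β len i.1).toGFData) ∧
        B8.Prop3Body cP 4 (F.L : ℝ) C₂ inp B₀β (fun i : {i : ZdIdx 4 F.L // i.Ω 0 = Set.univ} => (zdGF3 (Matrix (Fin N) (Fin N) ℂ) F.L β len i.1).toGFData2))
    (h7 : ∀ F : T4Family, ∃ C ε₀ : ℝ, 0 ≤ C ∧ 0 < ε₀ ∧ ∀ ε : ℝ, 0 < ε → ε ≤ ε₀ →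
      LeafH3sup 4 F.L (ne3NperOfRecord₁₁ F 0 0) ε (C * ε) (C * ε) (ne3DomOfRecord₁₁ F N 0 0)) :
    ∃ ℓ₃ : T4Family → NE3Letters₁₁,
      S_N16HolderMS β (RRec₁₃CoPH (readingOfRecord₁₃CoPH w1 ℓ₃ ne2 ne1)) ∧
      ∀ F : T4Family, (ℓ₃ F).g = g F ∧ (ℓ₃ F).Λ₁ = radiusOfRecordHMS N F.L (ne3NperOfRecord₁₁ F 0 0) ∧
        (ℓ₃ F).C = constOfRecordHMS N F.L (ne3NperOfRecord₁₁ F 0 0) (g F) ∧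
        0 < (ℓ₃ F).b ∧ 512 * (4 + 1) * (4 + 4) * (F.L : ℝ) ^ 2 * (ℓ₃ F).b ≤ 1 ∧ 0 < (ℓ₃ F).Λ₂' ∧
        InEndRegimeHMS (ne3OfRecord₁₁ F (ne3ConstLayerOfRecord₁₁ F N (ℓ₃ F))) ∧ LeafSlotHolderMS (ne3OfRecord₁₁ F (ne3ConstLayerOfRecord₁₁ F N (ℓ₃ F))) β := by
  choose ℓ₃ hℓ₃ using fun F => exists_letters_inEndRegimeHMS_leafSlotHolderMS_of_edges (N := N) (β := β) F (hg F) (h5 F) (h7 F)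
  exact ⟨ℓ₃, s_N16HolderMS_rRec₁₃CoPH_of_constLayer_leafSlotHolderMS hβ0 hβ1 _ (fun F => ne3ConstLayerOfRecord₁₁ F N (ℓ₃ F)) (fun _ _ _ _ _ _ => rfl)
    (fun F _ => (hℓ₃ F).2.2.2.2.2.2), hℓ₃⟩

end MS

end

end Summit.QuantumFields.YangMills.BalabanUVNodes.N16AtRecord13CoPHOfEdges
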